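import Summits.ABC.StewartYu.ArchG3RecLinesE
import Summits.ABC.StewartYu.ArchG3RecLinesCK
import Summits.ABC.StewartYu.ArchG3RecLinesHAtoms
import HarnessLib

/-!
# The archimedean record `ArchG3Rec` — letter lines in closed form: the (C)-SIDE ATOMS in `Z`-units, all step kinds, `κ ≤ 2ⁿ`
# (cell abc-stewartyu, rung A1.L, crux r2 `ArchCoreRat` stmt-ABC-20502, line `arch-g3-frame`; plan R50/R50′/R52)

Support file (theorems only; no named facts, no definitions). Seat p3 (g11), the HORIZONTAL (C)-cut of the (B)-grind of
`stub_recLinesArch` (STATUS 2026-08-27T22:31Z, R52).  For the closed letter lines `ArchG3Rec.LinesClosedK κ c`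
(`Summits/ABC/StewartYu/ArchG3RecLinesClosedK.lean`, p5) every cost of a third ("(C)", constant-coefficient) conjunct is paid by the box
ceiling `−U0 c` inside `cbRK`; this file bounds the (C)-terms one by one in the unit `Z = G·X·L`, uniformly in the step kind and the level,
for every `κ ≤ 2ⁿ` (the assembly takes `κ = 2^{n−1}`):
* `Z_units`, `Tf00_units` — the floors (`X ≤ Z/16`, `WN ≤ Z/(64(n+1))`, `(n+1)²L ≤ Z/512`, `2^36 ≤ Z`; `Tf 0 0·WN`, `(n+1)·Tf 0 0`, `Tf 0 0·H`
  `≤ (33/128, 33/1024, 33/128)·Z`);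
* `cUR_le_Z32` (`cUR ≤ Z/32`), `logWC_le_twoZ` (`log WC(H,e,L₀,T′,ρ) ≤ 2Z` for `e ≤ Ŝ`, `T′ ≤ Tf 0 0`, `ρ ≤ 2^{Ŝ−e}2^{n+6}e^G X`),
  `slab_mul_le`
  (`(γb lev + wl lev)·m ≤ 2ⁿZ` for `m ≤ 2^{n+2}2^{lev}X`), `log_LbRK_succ_le`/`log_nodes_succ_le`/`box_logs_le`
  (`log 2 + log(LbRK+1) + log(m+1) ≤ Z/8` for `m ≤ 2^{n+2}2^{Ŝ}X`), hence `cbRK_add_U0_le` (`cbRK κ c lev m + U0 c ≤ Z/8`) and the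
  smallness `smallZ_of_U0` (`LbRK·δ₀·m ≤ 1` once `Z ≤ U0 c`; renamed from `small_of_U0`, which p1's
  ✓ `ArchG3RecLinesG` declares with another signature — same-minute landings).
Atoms BY NAME: `cUR_le` (p1 D), `logWC_le`/`nodes_le`/`L₀_mul_le` (p1 E), `LbRK_le` (p4 CK), `slab_real`/`log_consts` (p5 HAtoms), `Tf00_le`/`L_H_le`/`Z_floors`/`Sd_log_le`/`log_letters_le`/`Tf_ge` (p1 B).  The half step's (C)-line
itself is `ArchG3RecLinesHC` (p3); K0/K and O (C)-lines are p4's `kStepC_holds` / p2's `oddC_holds` (owners kept them, R52).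

WHAT THIS IS NOT: no line of `LinesClosedK` is proved here; no START; no crux moves.

## References
* [Nesterenko2003] Yu. V. Nesterenko, *Linear forms in logarithms of rational numbers*, LNM 1819 (2003) — §4.2 (4.24)–(4.35),
  §4.3 (4.36)–(4.51), p. 87–95 (the constant-coefficient comparisons of the k-step and the half step).
-/

noncomputable section

open Finset Real
open scoped Nat
open Summit.ABC.StewartYu.ArchSupply (WC)
open Summit.ABC.StewartYu.ArchG3Setup (DΔC)

namespace Summit.ABC.StewartYu

namespace ArchG3Rec

open PadicG3Par (Cb Cb_pos)
open ArchG3Par (G K yloadK G_eq G_pos K_pos yloadK_pos eight_le_G one_le_K)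

variable {n : ℕ} (P : ArchG3Rec n)

/-! ### `Z`-unit floors used by every (C)-term -/

/-- the floors in `Z`-units: `0 < Z`, `X ≤ Z/16`, `WN ≤ Z/(64(n+1))`, `(n+1)²·L ≤ Z/512`, `2^36 ≤ Z`, `L ≤ Z/2^11`. [folklore] -/
theorem Z_units : 0 < P.Z ∧ (P.X : ℝ) ≤ P.Z / 16 ∧ P.WN ≤ P.Z / (64 * ((n : ℝ) + 1)) ∧
    ((n : ℝ) + 1) ^ 2 * P.L ≤ P.Z / 512 ∧ (2 : ℝ) ^ 36 ≤ P.Z ∧ (P.L : ℝ) ≤ P.Z / 2 ^ 11 := by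
  obtain ⟨hZ0, hLWN, hL2, hXL⟩ := P.Z_floors
  obtain ⟨hL1, hL0, hL25, -⟩ := P.L_real
  obtain ⟨hWN1, -, -, hWN0⟩ := P.WN_bounds
  obtain ⟨hG, hn1⟩ := P.sixteen_le_G'
  have hG0 := G_pos n
  have hX0 : (0 : ℝ) ≤ P.X := Nat.cast_nonneg _
  have hn0 : (0 : ℝ) ≤ n := Nat.cast_nonneg _
  have h4 : (4 : ℝ) ≤ ((n : ℝ) + 1) ^ 2 := by nlinarith
  refine ⟨hZ0, ?_, ?_, ?_, ?_, ?_⟩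
  · -- `X ≤ X·L = Z/G ≤ Z/16`
    have h1 : (P.X : ℝ) ≤ P.X * P.L := le_mul_of_one_le_right hX0 hL1
    have h2 : P.Z / G n ≤ P.Z / 16 := div_le_div_of_nonneg_left hZ0.le (by norm_num) hG
    linarith
  · rw [le_div_iff₀ (by positivity)]
    have : P.WN * (64 * ((n : ℝ) + 1)) * 1 ≤ P.WN * (64 * ((n : ℝ) + 1)) * P.L :=
      mul_le_mul_of_nonneg_left hL1 (by positivity)
    linarith
  · rw [le_div_iff₀ (by norm_num)]; linarith
  · have hnn := P.hn
    have h26 : (2 : ℝ) ^ 26 ≤ P.L := le_trans (pow_le_pow_right₀ (by norm_num) (by omega)) hL25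
    have e : (2 : ℝ) ^ 36 = 512 * 2 * 2 ^ 26 := by norm_num
    have : 512 * 4 * (2 : ℝ) ^ 26 ≤ 512 * ((n : ℝ) + 1) ^ 2 * P.L := by
      have := mul_le_mul h4 h26 (by positivity) (by positivity)
      linarith
    linarith
  · rw [le_div_iff₀ (by norm_num)]
    have : (P.L : ℝ) * 2 ^ 11 ≤ 512 * ((n : ℝ) + 1) ^ 2 * P.L := by nlinarith
    linarith

/-- the START order in `Z`-units (`n ≥ 2`): `Tf 0 0·WN ≤ (33/128)·Z`, `(n+1)·Tf 0 0 ≤ (33/1024)·Z`, `Tf 0 0·H ≤ (33/128)·Z`, and every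
order letter / every `a < Tf lev ν` is `≤ Tf 0 0`. [folklore] -/
theorem Tf00_units (hn2 : 2 ≤ n) : (P.Tf 0 0 : ℝ) * P.WN ≤ 33 / 128 * P.Z ∧ ((n : ℝ) + 1) * P.Tf 0 0 ≤ 33 / 1024 * P.Z ∧
    (P.Tf 0 0 : ℝ) * P.H ≤ 33 / 128 * P.Z ∧ (∀ lev ν, (P.Tf lev ν : ℝ) ≤ P.Tf 0 0) ∧ (0 : ℝ) ≤ P.Tf 0 0 := by
  have hT := P.Tf00_le hn2
  obtain ⟨hZ0, hLWN, hL2, -⟩ := P.Z_floors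
  have hLH := P.L_H_le
  have hWN0 := P.WN_bounds.2.2.2
  have hH0 : (0 : ℝ) ≤ P.H := Nat.cast_nonneg _
  have hn0 : (0 : ℝ) ≤ n := Nat.cast_nonneg _
  have hT0 : (0 : ℝ) ≤ P.Tf 0 0 := Nat.cast_nonneg _
  refine ⟨?_, ?_, ?_, fun lev ν => by exact_mod_cast P.Tf_le_Tf00 lev ν, hT0⟩
  · calc (P.Tf 0 0 : ℝ) * P.WN ≤ 33 / 2 * ((n : ℝ) + 1) * P.L * P.WN := by nlinarith
      _ ≤ 33 / 128 * P.Z := by nlinarith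
  · calc ((n : ℝ) + 1) * P.Tf 0 0 ≤ 33 / 2 * (((n : ℝ) + 1) ^ 2 * P.L) := by nlinarith
      _ ≤ 33 / 1024 * P.Z := by nlinarith
  · have h64 : P.Z / (64 * (n + 1)) * (33 / 2 * ((n : ℝ) + 1)) = 33 / 128 * P.Z := by field_simp; ring
    calc (P.Tf 0 0 : ℝ) * P.H ≤ 33 / 2 * ((n : ℝ) + 1) * (P.L * P.H) := by nlinarith
      _ ≤ 33 / 2 * ((n : ℝ) + 1) * (P.Z / (64 * (n + 1))) := by nlinarith
      _ = 33 / 128 * P.Z := by rw [← h64]; ring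


/-! ### The (C)-terms one by one, in `Z`-units -/

/-- `cUR ≤ Z/32`. [folklore] -/
theorem cUR_le_Z32 : P.cUR ≤ P.Z / 32 := by
  obtain ⟨hc, -⟩ := P.cUR_le
  obtain ⟨hZ0, -, hWN, hL2, h36, hLZ⟩ := P.Z_units
  have hy := yloadK_ge (n := n) P.hn
  obtain ⟨hG, hn1⟩ := P.sixteen_le_G'
  have hy0 := yloadK_pos n
  have hn0 : (0 : ℝ) ≤ n := Nat.cast_nonneg _
  have hWN0 := P.WN_bounds.2.2.2
  have hL0 := P.L_real.2.1
  -- `Z/(4 yloadK) ≤ Z/296`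
  have h1 : P.Z / (4 * yloadK n) ≤ P.Z / 296 := div_le_div_of_nonneg_left hZ0.le (by norm_num) (by linarith)
  -- `n·WN ≤ Z/64`
  have h2 : (n : ℝ) * P.WN ≤ P.Z / 64 := by
    rw [le_div_iff₀ (by positivity)] at hWN
    rw [le_div_iff₀ (by norm_num)]
    nlinarith
  -- `n·L ≤ Z/512`, `n + 1 ≤ Z/512`
  have h3 : (n : ℝ) * P.L ≤ P.Z / 512 := by
    have hsq : (n : ℝ) ≤ ((n : ℝ) + 1) ^ 2 := by nlinarith
    have : (n : ℝ) * P.L ≤ ((n : ℝ) + 1) ^ 2 * P.L := mul_le_mul_of_nonneg_right hsq hL0.le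
    linarith
  have h4 : (n : ℝ) + 1 ≤ P.Z / 512 := by
    have hL1 := P.L_real.1
    have hsq : (n : ℝ) + 1 ≤ ((n : ℝ) + 1) ^ 2 := by nlinarith
    have : ((n : ℝ) + 1) * 1 ≤ ((n : ℝ) + 1) ^ 2 * P.L := mul_le_mul hsq hL1 zero_le_one (by positivity)
    linarith
  have h5 : (n : ℝ) * (P.WN + P.L / 2 ^ 21 + 1) = n * P.WN + n * P.L / 2 ^ 21 + n := by ring
  rw [h5] at hc
  have h6 : (n : ℝ) * P.L / 2 ^ 21 ≤ P.Z / 512 / 2 ^ 21 := by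
    rw [div_le_div_iff_of_pos_right (by positivity)]; exact h3
  have h7 : P.Z / 512 / 2 ^ 21 ≤ P.Z / 2 ^ 30 := by
    rw [div_div, div_le_div_iff_of_pos_left hZ0 (by positivity) (by positivity)]; norm_num
  linarith

set_option maxHeartbeats 400000 in
/-- `log WC(H, e, L₀, T′, ρ) ≤ 2·Z` for `e ≤ Ŝ`, `T′ ≤ Tf 0 0`, `0 ≤ ρ ≤ 2^{Ŝ−e}·2^{n+6}·e^G·X` (`n ≥ 2`). [folklore] -/
theorem logWC_le_twoZ (hn2 : 2 ≤ n) {e : ℕ} (he : e ≤ P.Sd) {T' : ℕ} (hT' : T' ≤ P.Tf 0 0) {ρ : ℝ} (hρ0 : 0 ≤ ρ)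
    (hρ : ρ ≤ 2 ^ (P.Sd - e) * (2 : ℝ) ^ (n + 6) * Real.exp (G n) * P.X) :
    Real.log (WC P.H e P.L₀ T' ρ) ≤ 2 * P.Z := by
  have h := P.logWC_le he T' hρ0 hρ
  have hL0m := P.L₀_mul_le hn2
  obtain ⟨-, hSd⟩ := P.Sd_log_le
  obtain ⟨hTW, hTn, -, -, hT0⟩ := P.Tf00_units hn2
  obtain ⟨hZ0, hX, hWN, hL2, h36, -⟩ := P.Z_units
  obtain ⟨-, -, hlogN, -, -⟩ := P.log_letters_le
  have hN := P.N_facts.2.2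
  have hn0 : (0 : ℝ) ≤ n := Nat.cast_nonneg _
  have hT'r : (T' : ℝ) ≤ P.Tf 0 0 := by exact_mod_cast hT'
  have hT'0 : (0 : ℝ) ≤ T' := Nat.cast_nonneg _
  have hWN0 := P.WN_bounds.2.2.2
  -- `T'·(Ŝ log 2) ≤ Tf00·(10n + 29 + WN)`
  have hS1 : (P.Sd : ℝ) * Real.log 2 ≤ 10 * n + 29 + P.WN := by linarith
  have h1 : (T' : ℝ) * (P.Sd * Real.log 2) ≤ P.Tf 0 0 * (10 * n + 29 + P.WN) :=
    mul_le_mul hT'r hS1 (by positivity) hT0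
  -- `Tf00·(10n+29) ≤ (49/3)(n+1)·Tf00 ≤ (49/3)(33/1024) Z`
  have hn2r : (2 : ℝ) ≤ n := by exact_mod_cast hn2
  have h49 : (10 : ℝ) * n + 29 ≤ 49 / 3 * ((n : ℝ) + 1) := by linarith
  have h2 : (P.Tf 0 0 : ℝ) * (10 * n + 29) ≤ P.Tf 0 0 * (49 / 3 * ((n : ℝ) + 1)) := mul_le_mul_of_nonneg_left h49 hT0
  have h2' : (P.Tf 0 0 : ℝ) * (49 / 3 * ((n : ℝ) + 1)) = 49 / 3 * (((n : ℝ) + 1) * P.Tf 0 0) := by ring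
  -- the debris `19n + 47 + log N`
  have h4 : (n : ℝ) + 1 ≤ P.Z / 512 := by
    have hL1 := P.L_real.1
    have hsq : (n : ℝ) + 1 ≤ ((n : ℝ) + 1) ^ 2 := by nlinarith
    have : ((n : ℝ) + 1) * 1 ≤ ((n : ℝ) + 1) ^ 2 * P.L := mul_le_mul hsq hL1 zero_le_one (by positivity)
    linarith
  have hWN' : P.WN ≤ P.Z / 64 := by
    have : P.Z / (64 * ((n : ℝ) + 1)) ≤ P.Z / 64 :=
      div_le_div_of_nonneg_left hZ0.le (by norm_num) (by nlinarith)
    linarith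
  have h28 : (28 : ℝ) ≤ P.Z / 2 ^ 30 := by rw [le_div_iff₀ (by positivity)]; nlinarith
  have e1 : (P.Tf 0 0 : ℝ) * (10 * n + 29 + P.WN) = P.Tf 0 0 * (10 * n + 29) + P.Tf 0 0 * P.WN := by ring
  rw [e1] at h1
  linarith

set_option maxHeartbeats 400000 in
/-- the slab charge: `(γb lev + wl lev)·m ≤ 2ⁿ·Z` for `0 ≤ m ≤ 2^{n+2}·2^{lev}·X` (level `0`: `γb 0 ≤ (n+1)L/2`; deeper: `γb + wl ≤ 3·wl ≤ 3L/2^{10+lev}`).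
[folklore] -/
theorem slab_mul_le (lev : ℕ) {m : ℝ} (hm0 : 0 ≤ m) (hm : m ≤ 2 ^ (n + 2) * 2 ^ lev * P.X) :
    (P.γb lev + P.wl lev) * m ≤ 2 ^ n * P.Z := by
  obtain ⟨hZ0, -, -, -, -, -⟩ := P.Z_units
  obtain ⟨hZ0', -, -, hXL⟩ := P.Z_floors
  obtain ⟨hG, hn1⟩ := P.sixteen_le_G'
  have hG0 := G_pos n
  have hL0 := P.L_real.2.1
  have hX0 : (0 : ℝ) ≤ P.X := Nat.cast_nonneg _
  have hn0 : (0 : ℝ) ≤ n := Nat.cast_nonneg _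
  have h2n : (0 : ℝ) < 2 ^ n := by positivity
  -- `X·L = Z/G ≤ Z/16`
  have hXLle : (P.X : ℝ) * P.L ≤ P.Z / 16 := by
    rw [hXL]; exact div_le_div_of_nonneg_left hZ0.le (by norm_num) hG
  -- the coefficient `γb lev + wl lev ≤ (n+2)·L/2^{lev+1}`… in the two cases
  obtain ⟨hw0, hw, hexp, hγ0, hγ00, hγs⟩ := P.slab_real lev
  have hwle : P.wl lev ≤ (P.L : ℝ) / 2 ^ 10 / 2 ^ lev := by
    rw [hw, div_le_div_iff_of_pos_right (by positivity)]
    have := mul_le_mul_of_nonneg_left hexp hL0.le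
    simpa [one_div, div_eq_mul_inv] using this
  cases lev with
  | zero =>
    -- `(γb 0 + wl 0)·m ≤ ((n+1)L/2 + L/2^10)·2^{n+2}·X ≤ 2ⁿ·Z`
    have hco : P.γb 0 + P.wl 0 ≤ ((n : ℝ) + 2) * P.L / 2 := by
      have : (P.L : ℝ) / 2 ^ 10 / 2 ^ 0 ≤ P.L / 2 := by
        rw [pow_zero, div_one, div_le_div_iff_of_pos_left hL0 (by positivity) (by positivity)]; norm_num
      linarith
    have hco0 : 0 ≤ P.γb 0 + P.wl 0 := by linarith
    calc (P.γb 0 + P.wl 0) * m ≤ ((n : ℝ) + 2) * P.L / 2 * (2 ^ (n + 2) * 2 ^ 0 * P.X) :=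
          mul_le_mul hco hm hm0 (by positivity)
      _ = 2 ^ n * (((n : ℝ) + 2) * 2 * (P.X * P.L)) := by rw [pow_zero, pow_add]; ring
      _ = 2 ^ n * (((n : ℝ) + 2) * 2 * (P.Z / (8 * (n + 1)))) := by rw [hXL, G_eq]
      _ ≤ 2 ^ n * P.Z := by
          refine mul_le_mul_of_nonneg_left ?_ h2n.le
          rw [show ((n : ℝ) + 2) * 2 * (P.Z / (8 * (n + 1))) = P.Z * ((n + 2) / (4 * (n + 1))) by field_simp; ring]
          have : ((n : ℝ) + 2) / (4 * (n + 1)) ≤ 1 := by rw [div_le_one (by positivity)]; linarith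
          exact le_trans (mul_le_mul_of_nonneg_left this hZ0.le) (by rw [mul_one])
  | succ l =>
    -- `γb (l+1) + wl (l+1) ≤ wl l + wl (l+1) = 3·wl (l+1) ≤ 3L/2^{10+l+1}`
    have hws : P.wl l = 2 * P.wl (l + 1) := by have := (P.wl_facts l).1; linarith
    have hγ : P.γb (l + 1) ≤ P.wl l := (P.slab_real l).2.2.2.2.2
    have hco : P.γb (l + 1) + P.wl (l + 1) ≤ 3 * ((P.L : ℝ) / 2 ^ 10 / 2 ^ (l + 1)) := by linarith
    have hco0 : 0 ≤ P.γb (l + 1) + P.wl (l + 1) := by linarith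
    calc (P.γb (l + 1) + P.wl (l + 1)) * m ≤ 3 * ((P.L : ℝ) / 2 ^ 10 / 2 ^ (l + 1)) * (2 ^ (n + 2) * 2 ^ (l + 1) * P.X) :=
          mul_le_mul hco hm hm0 (by positivity)
      _ = 2 ^ n * (12 / 2 ^ 10 * (P.X * P.L)) := by rw [pow_add]; field_simp; ring
      _ ≤ 2 ^ n * (12 / 2 ^ 10 * (P.Z / 16)) := by
          refine mul_le_mul_of_nonneg_left (mul_le_mul_of_nonneg_left hXLle (by positivity)) h2n.le
      _ ≤ 2 ^ n * P.Z := mul_le_mul_of_nonneg_left (by nlinarith) h2n.le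

/-- the first logarithm of the box ceiling: `log(LbRK κ lev last + 1) ≤ (n+3)·log 2 + (n−1) + WN + L/2^21` for `κ ≤ 2ⁿ`
(`LbRK ≤ 4κn·N·L`). [folklore] -/
theorem log_LbRK_succ_le (κ : ℕ) (hκ : 1 ≤ κ) (hκ2 : (κ : ℝ) ≤ 2 ^ n) (lev : ℕ) :
    Real.log (P.LbRK κ lev P.jl + 1 : ℝ) ≤ (n + 3) * Real.log 2 + ((n : ℝ) - 1) + P.WN + P.L / 2 ^ 21 := by
  obtain ⟨-, -, hLb, hLb0⟩ := P.LbRK_le κ hκ lev P.jl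
  obtain ⟨hlogL, -, hlogN, -, -⟩ := P.log_letters_le
  obtain ⟨hN0, hN1, -⟩ := P.N_facts
  obtain ⟨hL1, hL0, -, -⟩ := P.L_real
  have hn1 : (1 : ℝ) ≤ n := by exact_mod_cast P.hn
  have hn0 : (0 : ℝ) < n := by linarith
  have hlogn : Real.log (n : ℝ) ≤ (n : ℝ) - 1 := Real.log_le_sub_one_of_pos hn0
  have hQ1 : (1 : ℝ) ≤ (n : ℝ) * (P.N * P.L) := one_le_mul_of_one_le_of_one_le hn1 (one_le_mul_of_one_le_of_one_le hN1 hL1)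
  have hA : (P.LbRK κ lev P.jl : ℝ) + 1 ≤ 2 ^ (n + 3) * ((n : ℝ) * (P.N * P.L)) := by
    have h1 : (κ : ℝ) * n * (P.N * P.L) ≤ 2 ^ n * (n * (P.N * P.L)) := by
      rw [mul_assoc]; exact mul_le_mul_of_nonneg_right hκ2 (by positivity)
    have e : (2 : ℝ) ^ (n + 3) = 8 * 2 ^ n := by rw [pow_add]; ring
    have h2Q : (1 : ℝ) ≤ 2 ^ n * ((n : ℝ) * (P.N * P.L)) := one_le_mul_of_one_le_of_one_le (one_le_pow₀ (by norm_num)) hQ1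
    rw [e]; linarith
  have hpos : (0 : ℝ) < P.LbRK κ lev P.jl + 1 := by linarith
  calc Real.log (P.LbRK κ lev P.jl + 1 : ℝ) ≤ Real.log (2 ^ (n + 3) * ((n : ℝ) * (P.N * P.L))) := Real.log_le_log hpos hA
    _ = (n + 3) * Real.log 2 + (Real.log n + (Real.log P.N + Real.log P.L)) := by
        rw [Real.log_mul (by positivity) (by positivity), Real.log_pow, Real.log_mul hn0.ne' (by positivity),
          Real.log_mul hN0.ne' hL0.ne']; push_cast; ring
    _ ≤ (n + 3) * Real.log 2 + ((n : ℝ) - 1) + P.WN + P.L / 2 ^ 21 := by linarith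

/-- the second logarithm of the box ceiling: `log(m + 1) ≤ (n+3)·log 2 + (10n + 29 + WN) + X` for `0 ≤ m ≤ 2^{n+2}·2^{Ŝ}·X`. [folklore] -/
theorem log_nodes_succ_le {m : ℝ} (hm0 : 0 ≤ m) (hm : m ≤ 2 ^ (n + 2) * 2 ^ P.Sd * P.X) :
    Real.log (m + 1) ≤ (n + 3) * Real.log 2 + (10 * n + 29 + P.WN) + P.X := by
  obtain ⟨-, hlogX, hlogN, -, -⟩ := P.log_letters_le
  obtain ⟨-, hSd⟩ := P.Sd_log_le
  have hX128 := P.X_floors.2.1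
  have hX1 : (1 : ℝ) ≤ P.X := by linarith
  have hX0 : (0 : ℝ) < P.X := by linarith
  have hB : m + 1 ≤ 2 ^ (n + 3) * (2 ^ P.Sd * (P.X : ℝ)) := by
    have h1 : (1 : ℝ) ≤ 2 ^ (n + 2) * (2 ^ P.Sd * (P.X : ℝ)) :=
      one_le_mul_of_one_le_of_one_le (one_le_pow₀ (by norm_num)) (one_le_mul_of_one_le_of_one_le (one_le_pow₀ (by norm_num)) hX1)
    have e : (2 : ℝ) ^ (n + 3) = 2 * 2 ^ (n + 2) := by rw [pow_succ]; ring
    rw [e]; nlinarith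
  have hpos : (0 : ℝ) < m + 1 := by linarith
  calc Real.log (m + 1) ≤ Real.log (2 ^ (n + 3) * (2 ^ P.Sd * (P.X : ℝ))) := Real.log_le_log hpos hB
    _ = (n + 3) * Real.log 2 + (P.Sd * Real.log 2 + Real.log P.X) := by
        rw [Real.log_mul (by positivity) (by positivity), Real.log_pow, Real.log_mul (by positivity) hX0.ne', Real.log_pow]
        push_cast; ring
    _ ≤ (n + 3) * Real.log 2 + (10 * n + 29 + P.WN) + P.X := by linarith

set_option maxHeartbeats 400000 in
/-- the two logarithms of the box ceiling together: `log 2 + log(LbRK κ lev last + 1) + log(m + 1) ≤ Z/8` for `κ ≤ 2ⁿ` and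
`0 ≤ m ≤ 2^{n+2}·2^{Ŝ}·X` (so `cbRK κ c lev m ≤ Z/8 − U0 c`, and the smallness `LbRK·δ₀·m ≤ 1` once `Z/8 ≤ U0 c`). [folklore] -/
theorem box_logs_le (κ : ℕ) (hκ : 1 ≤ κ) (hκ2 : (κ : ℝ) ≤ 2 ^ n) (lev : ℕ) {m : ℝ} (hm0 : 0 ≤ m)
    (hm : m ≤ 2 ^ (n + 2) * 2 ^ P.Sd * P.X) :
    Real.log 2 + Real.log (P.LbRK κ lev P.jl + 1 : ℝ) + Real.log (m + 1) ≤ P.Z / 8 := by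
  have hA := P.log_LbRK_succ_le κ hκ hκ2 lev
  have hB := P.log_nodes_succ_le hm0 hm
  obtain ⟨hZ0, hX, hWN, hL2, h36, hLZ⟩ := P.Z_units
  obtain ⟨hl2, -, -, -⟩ := log_consts
  have hL1 := P.L_real.1
  have hn0 : (0 : ℝ) ≤ n := Nat.cast_nonneg _
  have hn1 : (1 : ℝ) ≤ n := by exact_mod_cast P.hn
  have hWN' : P.WN ≤ P.Z / 128 := by
    have : P.Z / (64 * ((n : ℝ) + 1)) ≤ P.Z / 128 := div_le_div_of_nonneg_left hZ0.le (by norm_num) (by linarith)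
    linarith
  have hn' : (n : ℝ) + 1 ≤ P.Z / 512 := by
    have hsq : (n : ℝ) + 1 ≤ ((n : ℝ) + 1) ^ 2 := by nlinarith
    have : ((n : ℝ) + 1) * 1 ≤ ((n : ℝ) + 1) ^ 2 * P.L := mul_le_mul hsq hL1 zero_le_one (by positivity)
    linarith
  have h21 : (21 : ℝ) ≤ P.Z / 2 ^ 31 := by
    rw [le_div_iff₀ (by positivity)]
    have : (21 : ℝ) * 2 ^ 31 ≤ 2 ^ 36 := by norm_num
    linarith
  have hL' : (P.L : ℝ) / 2 ^ 21 ≤ P.Z / 2 ^ 32 := by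
    have : (P.L : ℝ) / 2 ^ 21 ≤ P.Z / 2 ^ 11 / 2 ^ 21 := by rw [div_le_div_iff_of_pos_right (by positivity)]; exact hLZ
    rw [div_div] at this
    exact le_trans this (by norm_num)
  have hl2n : ((n : ℝ) + 3) * Real.log 2 ≤ ((n : ℝ) + 3) * (7 / 10) := mul_le_mul_of_nonneg_left hl2 (by linarith)
  have h1 : 62 / 5 * ((n : ℝ) + 1) ≤ 62 / 5 * (P.Z / 512) := by linarith
  linarith

/-- the box ceiling in `Z`-units: `cbRK κ c lev m + U0 c ≤ Z/8` (`κ ≤ 2ⁿ`, `m ≤ 2^{n+2}·2^{Ŝ}·X`). [folklore] -/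
theorem cbRK_add_U0_le (κ : ℕ) (hκ : 1 ≤ κ) (hκ2 : (κ : ℝ) ≤ 2 ^ n) (c : ℝ) (lev m : ℕ)
    (hm : (m : ℝ) ≤ 2 ^ (n + 2) * 2 ^ P.Sd * P.X) : P.cbRK κ c lev m + P.U0 c ≤ P.Z / 8 := by
  have h := P.box_logs_le κ hκ hκ2 lev (Nat.cast_nonneg m) hm
  unfold cbRK; linarith

/-- **smallness** in `Z`-units: `LbRK κ lev last·δ₀·m ≤ 1` for `0 ≤ m ≤ 2^{n+2}·2^{Ŝ}·X` once `Z ≤ U0 c` (`κ ≤ 2ⁿ`). [folklore] -/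
theorem smallZ_of_U0 (κ : ℕ) (hκ : 1 ≤ κ) (hκ2 : (κ : ℝ) ≤ 2 ^ n) {c : ℝ} (hU0 : P.Z ≤ P.U0 c) (lev : ℕ) {m : ℝ}
    (hm0 : 0 ≤ m) (hm : m ≤ 2 ^ (n + 2) * 2 ^ P.Sd * P.X) : (P.LbRK κ lev P.jl : ℝ) * P.δR c * m ≤ 1 := by
  have h := P.box_logs_le κ hκ hκ2 lev hm0 hm
  have hZ0 := P.Z_units.1
  have hl2 : 0 < Real.log 2 := Real.log_pos one_lt_two
  have hLb0 : (0 : ℝ) ≤ P.LbRK κ lev P.jl := Nat.cast_nonneg _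
  -- `LbRK·m ≤ (LbRK+1)(m+1) = exp(log(LbRK+1) + log(m+1)) ≤ exp(U0 c)`
  have h1 : (P.LbRK κ lev P.jl : ℝ) * m ≤ Real.exp (P.U0 c) := by
    have hA : (0 : ℝ) < P.LbRK κ lev P.jl + 1 := by linarith
    have hB : (0 : ℝ) < m + 1 := by linarith
    calc (P.LbRK κ lev P.jl : ℝ) * m ≤ (P.LbRK κ lev P.jl + 1) * (m + 1) := by nlinarith
      _ = Real.exp (Real.log (P.LbRK κ lev P.jl + 1 : ℝ) + Real.log (m + 1)) := by
          rw [Real.exp_add, Real.exp_log hA, Real.exp_log hB]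
      _ ≤ Real.exp (P.U0 c) := Real.exp_le_exp.mpr (by linarith)
  unfold δR
  have e : (P.LbRK κ lev P.jl : ℝ) * Real.exp (-P.U0 c) * m = (P.LbRK κ lev P.jl : ℝ) * m * Real.exp (-P.U0 c) := by ring
  rw [e, Real.exp_neg, ← div_eq_mul_inv, div_le_one (Real.exp_pos _)]
  exact h1

end ArchG3Rec

end Summit.ABC.StewartYu

end
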